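/-
SKELETON for crux item stmt-PneNP-18538 (`StrongComposition`, C1) — line `lra-gluing` (the rung C1|LRA), v1 (registration).
Crux directory: Summits/PneNP/PneNP/Cruxes/StrongComposition/.  Line card: `Lines/lra_gluing.md` (planner pnp-ideate-p4 g24).
ONE registered stub: `stub_lraQuantitative : LRAQuantitative` (the `t`-free adversary bound on the untyped class LRA, loss
LOGARITHMIC).  The composition `StrongCompositionLRA_of` (S0⁺ — landed `KrwLrb.stub_jointSubspaceHard` — and the stub give the
rung) is kernel-checked; so are the links rung LRA ⟹ rung LRX_t ⟹ rung LRB ⟹ rung LRAD (all three lower rungs PROVED and landed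
today) and C1 ⟹ rung LRA, and non-vacuity.  The stub's BOOKS SIDE is kernel-checked in `Cruxes/StrongComposition/NextRungP4g23.lean`
(`P4g23X.BState.Run.jprime / .bankStar / .retiredFloorGe`, 0 sorry); what the stub still needs is the protocol → books dictionary
(memo `LensBarrierP4g22.md` §6 F0–F3, `LensBarrierP4g23.md` §6–§7) and the label side (`LensBarrierP4g21.md` §3; forced-half lemmas
`P4g21X.multiForcedHalf_alice/bob`, retirement `P4g22X.retire_two`, all proved in crux workfiles).  FRONTIER rung; the crux C1 (all
protocols) stays OPEN; nothing here bears on P vs NP.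
-/
import Mathlib
import Summits.PneNP.PneNP.Theorems.KrwChromaticSteeringStrongCompositionLrxRung
import Summits.PneNP.PneNP.Theorems.KrwChromaticSteeringStrongCompositionLradRouteLink
import Literature.Computability.Complexity.KRWComposition

/-!
# Line `lra-gluing`: the rung C1|LRA — skeleton v1 (REGISTRATION; 1 stub)

Target (registered with `--crux-decl`): `StrongCompositionLRA` — C1 (`Theses.KrwChromaticSteering.StrongComposition`) verbatim,
restricted to protocols of the UNTYPED class LRA (`LabelRowAffine g P`: every node test, of either player, is a label test, a
single-row test or an affine test — any rows, any order, no typing discipline, no crossing budget; = `P4g18.LabelRowAffine`,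
`P4g21X.LabelRowAffine`, here over the landed `KrwLrad.IsLabelTest / IsRowTest / IsAffineTest`).  Every `LRX_t`-disciplined tree is
LRA (`lra_of_lrxOn`), so this rung contains the PROVED rungs C1|LRX_t (`KrwLrx.strongCompositionLRX`, loss `6 (log₂ mn + 1) + t`),
C1|LRB and C1|LRAD (§5), and it is implied by C1 (`lra_of_strongComposition`).  It is the LAST restricted-class rung below C1 on
this ladder: above LRA = all protocols = the crux itself (lead g1 (ii); `Lines/lrx_gluing.md`).

What is new relative to LRX_t (why a separate line): the LRX_t bound charges a type-A node (an affine test through rows already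
cut by single-row tests) its full crossing weight, so it is EMPTY on LRA; the `t`-free bound needs a potential that prices several
simultaneous single-row restrictions below their number — the declared-row adversary with literal pre-payment (memo P4g21 §3),
label-cashing RETIREMENT (P4g22 §5, `retire_two`) and the 2-retired floor `M*`, whose load-side bookkeeping is the theorem
(J′) `2K + D ≤ #bits + 2·#closes` of the exact books (P4g23 §3–§4), kernel-checked for every run of the books machine
(`P4g23X.BState.Run.jprime`).  The loss of `LRAQuantitative` is therefore typed LOGARITHMIC and existential (`C · (log₂ mn + 1)`,
P4g21X typing note 4c(iv)): the multi-forced-half lemma prices a closure with `k` kills at `1 + ⌈log₂ k⌉` label units, and although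
(J′) shows the linear charge `k` is affordable in the books, the rung must not hand-pick the constant.

§1 the class; §2 the target and the load-bearing stub STATEMENT; §3 the registered stub; §4 the composition (kernel-checked:
S0⁺ landed + stub ⟹ rung, loss `(c + C + 2)(log₂ mn + 1)`); §5 links (C1 ⟹ rung; rung ⟹ LRX_t ⟹ LRB ⟹ LRAD); §6 non-vacuity.
-/

set_option linter.dupNamespace false
set_option autoImplicit false

namespace Summit.PneNP.PneNP.Cruxes.StrongComposition.LraGluing

open Literature.Computability.Complexity
open Summit.PneNP.PneNP.Theorems.KrwLrad
open Summit.PneNP.PneNP.Theorems.KrwLrb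
open Summit.PneNP.PneNP.Theorems.KrwLrx

/-! ## §1 The class LRA (untyped: label ∨ single-row ∨ affine node tests, both players) -/

section ClassLRA

variable {m n : ℕ}

/-- [verbatim `P4g18.LabelRowAffine` = `P4g21X.LabelRowAffine`, over the landed `KrwLrad` test predicates] **class LRA**: every
node test is a label test (`KrwLrad.IsLabelTest g`), a single-row test (`KrwLrad.IsRowTest`) or an affine test (`KrwLrad.IsAffineTest`);
no typing, no order, no budget. -/
def LabelRowAffine (g : (Fin n → Bool) → Bool) : KWTree (Fin m × Fin n) → Prop
  | .leaf _ => True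
  | .alice s P Q => (IsLabelTest g s ∨ IsRowTest s ∨ IsAffineTest s) ∧ LabelRowAffine g P ∧ LabelRowAffine g Q
  | .bob s P Q => (IsLabelTest g s ∨ IsRowTest s ∨ IsAffineTest s) ∧ LabelRowAffine g P ∧ LabelRowAffine g Q

@[simp] theorem labelRowAffine_leaf (g : (Fin n → Bool) → Bool) (p : Fin m × Fin n) :
    LabelRowAffine g (KWTree.leaf p) := trivial

/-- A node admissible in `LRX` at some typing (landed `KrwLrb.NodeOKX`) is an LRA node test. -/
theorem lra_test_of_nodeOKX {g : (Fin n → Bool) → Bool} {τ τ' : Fin m → RowTypeX}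
    {s : (Fin m × Fin n → Bool) → Bool} {w : ℕ} (h : NodeOKX g τ s τ' w) :
    IsLabelTest g s ∨ IsRowTest s ∨ IsAffineTest s := by
  rcases h with ⟨hl, -, -⟩ | ⟨U, c, hs, -, -⟩ | ⟨i, ψ, hs, -, -⟩
  · exact Or.inl hl
  · exact Or.inr (Or.inr ⟨U, c, hs⟩)
  · exact Or.inr (Or.inl ⟨i, ψ, hs⟩)

/-- **`LRX_t ⊆ LRA` below any typing**: an `LRXDisciplinedOn g t τ` tree is `LabelRowAffine g`. -/
theorem lra_of_lrxOn (g : (Fin n → Bool) → Bool) :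
    ∀ (P : KWTree (Fin m × Fin n)) (t : ℕ) (τ : Fin m → RowTypeX), LRXDisciplinedOn g t τ P → LabelRowAffine g P
  | .leaf _, _, _, _ => trivial
  | .alice s P Q, t, τ, h => by
      obtain ⟨τ', w, hN, -, hP, hQ⟩ := h
      exact ⟨lra_test_of_nodeOKX hN, lra_of_lrxOn g P _ _ hP, lra_of_lrxOn g Q _ _ hQ⟩
  | .bob s P Q, t, τ, h => by
      obtain ⟨τ', w, hN, -, hP, hQ⟩ := h
      exact ⟨lra_test_of_nodeOKX hN, lra_of_lrxOn g P _ _ hP, lra_of_lrxOn g Q _ _ hQ⟩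

/-- `LRX_t ⊆ LRA` from the all-fresh typing (landed `KrwLrb.LRXDisciplined`). -/
theorem lra_of_lrx {g : (Fin n → Bool) → Bool} {t : ℕ} {P : KWTree (Fin m × Fin n)} (h : LRXDisciplined g t P) :
    LabelRowAffine g P :=
  lra_of_lrxOn g P t _ h

/-- `LRB ⊆ LRA` (landed `KrwLrb.LRBDisciplined` = `LRX_0`). -/
theorem lra_of_lrb {g : (Fin n → Bool) → Bool} {P : KWTree (Fin m × Fin n)} (h : LRBDisciplined g P) :
    LabelRowAffine g P :=
  lra_of_lrx h

end ClassLRA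

/-! ## §2 Target and the load-bearing stub STATEMENT -/

/-- [verbatim `P4g18.StrongCompositionLRA` = `P4g21X.StrongCompositionLRA`] **the registered target: rung C1|LRA** (OPEN) — strong
composition with C1's own loss for every protocol whose node tests are label tests, single-row tests or affine tests. -/
def StrongCompositionLRA : Prop :=
  ∃ c : ℕ, ∀ m n : ℕ, 1 ≤ n → ∀ f : (Fin m → Bool) → Bool, (∃ a b, f a ≠ f b) →
    ∃ g : (Fin n → Bool) → Bool, ∀ P : KWTree (Fin m × Fin n), LabelRowAffine g P → P.SolvesStrong f g →
      ∃ Q : KWTree (Fin m), Q.Solves f ∧ Q.depth + n ≤ P.depth + c * (Nat.log 2 (m * n) + 1)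

/-- [verbatim `P4g21X.LRAQuantitative`] **the load-bearing stub statement** (the `t`-free adversary bound on LRA): every LRA
protocol for the strong game of a non-constant `f` (label rectangle `ℓ`-hard) against an `r`-affinely-generic, `q`-subspace-hard `g`
with `q + r + 1 ≤ n`, `1 ≤ q`, has depth `≥ ℓ + (q − 1) − C · (log₂ (m n) + 1)` — additive loss LOGARITHMIC and existential (the
multi-forced-half lemma prices a closure with `k` kills at `1 + ⌈log₂ k⌉`; an absolute `C` would be a hand-picked constant, typing
checklist 4c(iv); the rung absorbs `C · (log₂ mn + 1)`).  Shape of the landed `KrwLrx.LRXQuantitative` with the class widened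
`LRX_t ↦ LRA` and `C + t ↦ C · (log₂ (m n) + 1)`. -/
def LRAQuantitative : Prop :=
  ∃ C : ℕ, ∀ (m n q r ℓ : ℕ) (f : (Fin m → Bool) → Bool) (g : (Fin n → Bool) → Bool),
    (∃ a b, f a = true ∧ f b = false) →
    AffGeneric g r → q + r + 1 ≤ n → SubspaceHard g q → 1 ≤ q →
    Hard (f ⁻¹' {true}) (f ⁻¹' {false}) ℓ →
    ∀ P : KWTree (Fin m × Fin n), LabelRowAffine g P → P.SolvesStrong f g →
      ℓ + (q - 1) ≤ P.depth + C * (Nat.log 2 (m * n) + 1)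

/-! ## §3 The registered stub -/

/-- **STUB (load-bearing, the whole difficulty of the rung): the `t`-free adversary bound on LRA.**  Proof plan (line card §Stubs):
the declared-row adversary with literal pre-payment `π` (memo `LensBarrierP4g21.md` §3: routing of declared rows = `KrwLrad.Hard`
split, `P4g21X.hard_split_alice/bob`; forced kills = `P4g21X.forcedHalf_* / multiForcedHalf_*`, proved), label-cashing
retirement (`P4g22X.retire_two`, proved) and the 2-retired floor; load side = the exact books, whose inequality
(J′) `2K + D ≤ #bits + 2·#closes` is PROVED for every run of the books machine (`P4g23X.BState.Run.jprime`, `.bankStar`,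
`.retiredFloorGe`, `NextRungP4g23.lean`, 0 sorry); missing = the protocol → books dictionary F0–F3 (`LensBarrierP4g22.md` §6,
`LensBarrierP4g23.md` §6–§7) and the leaf/root bookkeeping in the shape of the landed `KrwLrx.rect_bound_of_invAt`. -/
theorem stub_lraQuantitative : LRAQuantitative := by
  sorry

/-! ## §4 Composition (kernel-checked): the landed S0⁺ and the stub give the rung -/

section Assembly

/-- **Assembly of the rung** from S0⁺ (`KrwLrb.jointSubspaceHard_exists`, landed, `c = 3`) and the adversary bound ALONE, loss
`(c + C + 2) (log₂ (m n) + 1)` where `C` is the stub's logarithmic constant [adapted from the landed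
`KrwLrx.strongCompositionLRX_of_quantitative`: the budget `t` is gone and the stub's loss is `C · L` instead of `C`].  Large `n`
(`c (log₂ n + 1) + 2 ≤ n`, budget `q = n − r − 1 ≥ 1`, `r = c (log₂ n + 1)`): S0⁺'s `g`, the bound in contrapositive form; tiny `n`: a
dictator `g` and the `liftRows` embedding already fit. -/
theorem assembly_of_quantitative (h0 : jointSubspaceHard_exists) (hQ : LRAQuantitative) :
    ∃ c : ℕ, ∀ m n : ℕ, 1 ≤ n → ∀ f : (Fin m → Bool) → Bool, (∃ a b, f a ≠ f b) →
      ∃ g : (Fin n → Bool) → Bool, ∀ P : KWTree (Fin m × Fin n), LabelRowAffine g P → P.SolvesStrong f g →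
        ∃ Q : KWTree (Fin m), Q.Solves f ∧ Q.depth + n ≤ P.depth + c * (Nat.log 2 (m * n) + 1) := by
  obtain ⟨c, hc⟩ := h0
  obtain ⟨C, hQ⟩ := hQ
  refine ⟨c + C + 2, fun m n hn f hf => ?_⟩
  have hne : ∃ a b, f a = true ∧ f b = false := by
    obtain ⟨a, b, hab⟩ := hf
    cases ha : f a <;> cases hb : f b
    · rw [ha, hb] at hab; exact absurd rfl hab
    · exact ⟨b, a, hb, ha⟩
    · exact ⟨a, b, ha, hb⟩
    · rw [ha, hb] at hab; exact absurd rfl hab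
  have hm : 0 < m := by
    obtain ⟨a, b, hab⟩ := hf
    rcases Nat.eq_zero_or_pos m with h0 | h0
    · exfalso; subst h0; exact hab (congrArg f (funext fun i => i.elim0))
    · exact h0
  set L := Nat.log 2 (m * n) + 1 with hL
  have hLn : Nat.log 2 n + 1 ≤ L := by
    have : Nat.log 2 n ≤ Nat.log 2 (m * n) := Nat.log_mono_right (Nat.le_mul_of_pos_left n hm)
    omega
  set r := c * (Nat.log 2 n + 1) with hr
  have hcL : r ≤ c * L := Nat.mul_le_mul_left _ hLn
  have hL1 : 1 ≤ L := by omega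
  have e1 : (c + C + 2) * L = c * L + C * L + 2 * L := by ring
  by_cases hbig : r + 2 ≤ n
  · -- large `n`: S0⁺'s inner function, budget `q = n - r - 1 ≥ 1`
    obtain ⟨g, hgen, hsub⟩ := hc n (by omega)
    refine ⟨g, fun P hP hsol => ?_⟩
    set q := n - r - 1 with hq
    have hq1 : 1 ≤ q := by omega
    have hqn : q + r + 1 ≤ n := by omega
    by_contra hcon
    push Not at hcon
    set ℓ := P.depth + (c + C + 2) * L + 1 - n with hℓ
    have hH : Hard (f ⁻¹' {true}) (f ⁻¹' {false}) ℓ := by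
      intro Q hQs
      have hs : Q.Solves f := fun a b ha hb => hQs a (by simpa using ha) b (by simpa using hb)
      have := hcon Q hs
      omega
    have hmain := hQ m n q r ℓ f g hne hgen hqn hsub hq1 hH P hP hsol
    rw [← hL] at hmain
    omega
  · -- tiny `n` (`n ≤ r + 1 ≤ c L + 1`): a dictator and the `liftRows` protocol
    refine ⟨fun x => x ⟨0, by omega⟩, fun P hP hsol => ?_⟩
    refine ⟨P.comap (KWTree.liftRows (fun _ => true) (fun _ => false))
        (KWTree.liftRows (fun _ => true) (fun _ => false)) Prod.fst,
      KWTree.solves_comap_liftRows hsol rfl rfl, ?_⟩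
    rw [KWTree.depth_comap]
    have h2L : 2 * L = L + L := by ring
    nlinarith [hcL, hL1]

/-- **The skeleton's concluding theorem** (registrar shape: the ONLY theorem of this file whose result type is the rung decl by
name; it uses the registered stub by name and the landed S0⁺; `assembly_of_quantitative` states the rung's body verbatim so that it
is not a second candidate). -/
theorem StrongCompositionLRA_of : StrongCompositionLRA :=
  assembly_of_quantitative Summit.PneNP.PneNP.Theorems.KrwLrb.stub_jointSubspaceHard stub_lraQuantitative

end Assembly

/-! ## §5 Links: C1 ⟹ rung LRA ⟹ rung LRX_t ⟹ rung LRB ⟹ rung LRAD -/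

section Links

/-- C1 implies its LRA restriction (LRA is a syntactic subclass of all protocols): a refutation of the rung would refute C1. -/
theorem lra_of_strongComposition :
    Theses.KrwChromaticSteering.StrongComposition → StrongCompositionLRA := by
  rintro ⟨c, h⟩
  refine ⟨c, fun m n hn f hf => ?_⟩
  obtain ⟨g, hg⟩ := h m n hn f hf
  exact ⟨g, fun P _ hP => hg P hP⟩

/-- **Rung LRA ⟹ rung LRX_t** (landed `KrwLrx.StrongCompositionLRX`, PROVED as `KrwLrx.strongCompositionLRX`): every `LRX_t` tree is
LRA and the LRA loss `c (log₂ mn + 1)` is at most the LRX loss `c (log₂ mn + 1) + t`. -/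
theorem strongCompositionLRX_of_LRA (h : StrongCompositionLRA) :
    Summit.PneNP.PneNP.Theorems.KrwLrx.StrongCompositionLRX := by
  obtain ⟨c, hc⟩ := h
  refine ⟨c, fun m n hn f hf => ?_⟩
  obtain ⟨g, hg⟩ := hc m n hn f hf
  refine ⟨g, fun t P hP hsol => ?_⟩
  obtain ⟨Q, hQ, hd⟩ := hg P (lra_of_lrx hP) hsol
  exact ⟨Q, hQ, by omega⟩

/-- … hence rung LRA ⟹ rung LRB (landed `KrwLrb.StrongCompositionLRB`, PROVED). -/
theorem strongCompositionLRB_of_LRA (h : StrongCompositionLRA) :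
    Summit.PneNP.PneNP.Theorems.KrwLrb.StrongCompositionLRB :=
  strongCompositionLRB_of_LRX (strongCompositionLRX_of_LRA h)

/-- … hence rung LRA ⟹ rung LRAD (landed `KrwLrad.StrongCompositionLRAD`, PROVED). -/
theorem strongCompositionLRAD_of_LRA (h : StrongCompositionLRA) : StrongCompositionLRAD :=
  strongCompositionLRAD_of_LRX (strongCompositionLRX_of_LRA h)

/-- The quantitative statements compare the same way: the LRA bound gives the LRX bound with the SAME logarithmic constant in
place of LRX's absolute one — recorded as the implication into the log-relaxed LRX shape (the landed `KrwLrx.LRXQuantitative` has an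
absolute `C`, which `LRAQuantitative` does not claim). -/
theorem lrxQuantitativeLog_of_lra (h : LRAQuantitative) :
    ∃ C : ℕ, ∀ (m n q r ℓ t : ℕ) (f : (Fin m → Bool) → Bool) (g : (Fin n → Bool) → Bool),
      (∃ a b, f a = true ∧ f b = false) →
      AffGeneric g r → q + r + 1 ≤ n → SubspaceHard g q → 1 ≤ q →
      Hard (f ⁻¹' {true}) (f ⁻¹' {false}) ℓ →
      ∀ P : KWTree (Fin m × Fin n), LRXDisciplined g t P → P.SolvesStrong f g →
        ℓ + (q - 1) ≤ P.depth + C * (Nat.log 2 (m * n) + 1) + t := by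
  obtain ⟨C, hC⟩ := h
  refine ⟨C, fun m n q r ℓ t f g hne hgen hqn hsub hq1 hH P hP hsol => ?_⟩
  have := hC m n q r ℓ f g hne hgen hqn hsub hq1 hH P (lra_of_lrx hP) hsol
  omega

end Links

/-! ## §6 Non-vacuity: independent play is LRA, so inside the class the rung is matched from above up to its `O(log mn)` loss;
and genuinely untyped paths exist (an affine test through a row ALREADY cut by a single-row test, then a second single-row test on a
row the affine test touched — outside every `LRX_t` budget accounting only through its weight, inside LRA by definition). -/

section NonVacuity

variable {m n : ℕ}

/-- **Independent play is LRA** (landed `KrwLrb.lrb_compose` + `lra_of_lrb`). -/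
theorem lra_compose (g : (Fin n → Bool) → Bool) (R : KWTree (Fin n)) (Q : KWTree (Fin m)) :
    LabelRowAffine g (KWTree.compose g R Q) :=
  lra_of_lrb (lrb_compose g R Q)

/-- From any `KW_f` protocol `Q` and `KW_g` protocol `R`, an LRA protocol for the strong game of depth `Q.depth + R.depth + 1`. -/
theorem exists_lra_solvesStrong {f : (Fin m → Bool) → Bool} {g : (Fin n → Bool) → Bool}
    {Q : KWTree (Fin m)} {R : KWTree (Fin n)} (hQ : Q.Solves f) (hR : R.Solves g) :
    ∃ P : KWTree (Fin m × Fin n), LabelRowAffine g P ∧ P.SolvesStrong f g ∧ P.depth = Q.depth + R.depth + 1 := by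
  obtain ⟨P, hP, hs, hd⟩ := exists_lrb_solvesStrong hQ hR
  exact ⟨P, lra_of_lrb hP, hs, hd⟩

/-- A genuinely untyped LRA path: single-row test on row `i`, then an affine test through that (now combinatorial) row, then a
single-row test on row `i` again — LRA by definition (each node is a row test or an affine test). -/
theorem lra_row_affine_row (g : (Fin n → Bool) → Bool) (i : Fin m) (j : Fin n) (ψ ψ' : (Fin n → Bool) → Bool)
    (p₁ p₂ p₃ p₄ : Fin m × Fin n) :
    LabelRowAffine g
      (KWTree.alice (fun X => ψ (row X i))
        (KWTree.bob (fun Y => Bool.xor false (parityOn {(i, j)} Y))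
          (KWTree.alice (fun X => ψ' (row X i)) (KWTree.leaf p₁) (KWTree.leaf p₂))
          (KWTree.leaf p₃))
        (KWTree.leaf p₄)) := by
  refine ⟨Or.inr (Or.inl ⟨i, ψ, fun X => rfl⟩), ?_, trivial⟩
  refine ⟨Or.inr (Or.inr ⟨{(i, j)}, false, fun Y => rfl⟩), ?_, trivial⟩
  exact ⟨Or.inr (Or.inl ⟨i, ψ', fun X => rfl⟩), trivial, trivial⟩

end NonVacuity

end Summit.PneNP.PneNP.Cruxes.StrongComposition.LraGluing
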